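import Summits.ResolutionOfSingularities.ResolutionOfSingularities.Theorems.PurelyInseparableDim4ResConeAlternation
import HarnessLib

/-!
# The NEWBORN letter is never a cone letter: at every constant-shade step of an above-floor isolated chain with constant `e_G`,
# the child's residual-cone vertex has a vector with non-zero coordinate at the chart letter (cell `res-dim4-pi`, K2(p) lane, rung 1)

[OURS · counted 0 · cell `res-dim4-pi` · seat res-dim4-p-11 g5.]  Nothing here proves any TAIL(p, d, e), K2(p) or resolution of
singularities in dimension ≥ 4 / characteristic `p` — NOT proved.  AI kernel work, weaker than expert review.

res-dim4-p-9 g5's `…ResConeConeLetterEntry` (p711866) proves that a letter `W` which is KEPT and UNTRANSLATED at step `k`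
(`j k ≠ W`, `b k W = 0`) is a cone letter at `k` if it is one at `k + 1` (`coneLetter_of_succ`).  This file adds the complementary fact
about the CHART letter `j k` itself — the letter that is (re)born at step `k`: it is NEVER a cone letter of the child,

* **`newborn_transversal`**: `∃ w ∈ resVertex (c (k+1)), w (j k) ≠ 0`;  **`not_coneLetter_newborn`**: `¬ ∀ v ∈ resVertex (c (k+1)), v (j k) = 0`;
  **`ne_chart_of_coneLetter_succ`**: a cone letter of `c (k+1)` is `≠ j k`.

Proof: by (I2) `chain_resVertex_step_inf_hyperplane_eq` the kernels of parent and child agree inside the hyperplane `H_{j k}`; if the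
child's kernel lay inside `H_{j k}` it would be contained in the parent's, hence equal to it (same `finrank`), but the parent's kernel
contains the step direction (`chain_direction_mem_resVertex`), whose `j k`-coordinate is `1`.  Consequence for the census (CONE column,
res-dim4-eng-w4/w6): cone letters are always OLD letters — a kernel falsifier per constant-shade step.  [cite: CossartJannsenSaito2020, Thm. 3.14]
[cite: HauserPerlega2019PRIMS, §2] bears_on: LADDER-RESOLUTION:D157-DOOR2 (res-dim4-pi · K2(p) rung 1 · cone letters).  Supports
stmt-ResolutionOfSingularities-16155 (helper).
-/

set_option linter.dupNamespace false -- mandated namespace of this single-conjunct summit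

noncomputable section

namespace Summit.ResolutionOfSingularities.ResolutionOfSingularities.Theorems.PIDim4

namespace ResCone

open MvPolynomial Finset IsLocalRing
open Literature.AlgebraicGeometry.Resolution
open Literature.AlgebraicGeometry.Resolution.CentreBlowup
open Literature.AlgebraicGeometry.Resolution.Hauser2010
open Literature.AlgebraicGeometry.Resolution.HauserPerlega2019
open PointBlowup (additiveSubspace direction)

variable {K : Type} [Field K]

section

variable (p : ℕ) [Fact p.Prime] [DecidableEq K]

/-- **The newborn letter is transversal to the child's vertex.**  Along a witnessed isolated above-floor `Step0 p` chain with
`x^{r₀} ∣ F₀`, constant shade and constant `e_G = e` from `k₀`: for every `k ≥ k₀` some kernel vector of the child `c (k+1)` has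
non-zero `j k`-coordinate. [cite: CossartJannsenSaito2020, Thm. 3.14] -/
theorem newborn_transversal {c : ℕ → State K} {j : ℕ → Fin 4} {b : ℕ → Fin 4 → K}
    (hc : ∀ k, IsIsolated p (c k).F ∧ Step0 p (c k) (c (k + 1))) (hw : FreeTail.IsWitnessedChain p c j b)
    (hr0 : ∀ e ∈ (c 0).F.support, (c 0).r ≤ e) (hfloor : ∀ k, ordZero (c k).F ≠ p) {k₀ : ℕ} {d : ℕ∞}
    (hshade : ∀ k, k₀ ≤ k → (c k).shade = d) {e : ℕ}
    (he : ∀ k, k₀ ≤ k → Module.finrank K (resVertex (c k)) = e) {k : ℕ} (hk : k₀ ≤ k) :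
    ∃ w ∈ resVertex (c (k + 1)), w (j k) ≠ 0 := by
  by_contra h
  push Not at h
  -- the child's kernel lies inside `H_{j k}`, hence inside the parent's kernel
  have hI2 := chain_resVertex_step_inf_hyperplane_eq p hc hw hr0 hfloor hshade he hk
  have hle : resVertex (c (k + 1)) ≤ resVertex (c k) := by
    intro v hv
    have hvH : v ∈ resVertex (c (k + 1)) ⊓ hyperplane (j k) := ⟨hv, mem_hyperplane.mpr (h v hv)⟩
    rw [hI2] at hvH
    exact hvH.1
  -- same finrank ⇒ equal
  have heq : resVertex (c (k + 1)) = resVertex (c k) :=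
    Submodule.eq_of_le_of_finrank_eq hle (by rw [he (k + 1) (by omega), he k hk])
  -- but the step direction lies in the parent's kernel and has `j k`-coordinate `1`
  have hdir : direction (j k) (b k) ∈ resVertex (c k) := chain_direction_mem_resVertex p hc hw hr0 hfloor hshade hk
  rw [← heq] at hdir
  have h1 := h _ hdir
  rw [direction_apply_self] at h1
  exact one_ne_zero h1

/-- **The newborn letter is not a cone letter of the child** (`¬ ∀ v ∈ resVertex (c (k+1)), v (j k) = 0`), same hypotheses.
[cite: CossartJannsenSaito2020, Thm. 3.14] -/
theorem not_coneLetter_newborn {c : ℕ → State K} {j : ℕ → Fin 4} {b : ℕ → Fin 4 → K}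
    (hc : ∀ k, IsIsolated p (c k).F ∧ Step0 p (c k) (c (k + 1))) (hw : FreeTail.IsWitnessedChain p c j b)
    (hr0 : ∀ e ∈ (c 0).F.support, (c 0).r ≤ e) (hfloor : ∀ k, ordZero (c k).F ≠ p) {k₀ : ℕ} {d : ℕ∞}
    (hshade : ∀ k, k₀ ≤ k → (c k).shade = d) {e : ℕ}
    (he : ∀ k, k₀ ≤ k → Module.finrank K (resVertex (c k)) = e) {k : ℕ} (hk : k₀ ≤ k) :
    ¬ ∀ v ∈ resVertex (c (k + 1)), v (j k) = 0 := by
  intro h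
  obtain ⟨w, hw', hwj⟩ := newborn_transversal p hc hw hr0 hfloor hshade he hk
  exact hwj (h w hw')

/-- **Cone letters are old letters**: a cone letter of `c (k+1)` (`k ≥ k₀`) differs from the chart letter `j k`.
[cite: CossartJannsenSaito2020, Thm. 3.14] -/
theorem ne_chart_of_coneLetter_succ {c : ℕ → State K} {j : ℕ → Fin 4} {b : ℕ → Fin 4 → K}
    (hc : ∀ k, IsIsolated p (c k).F ∧ Step0 p (c k) (c (k + 1))) (hw : FreeTail.IsWitnessedChain p c j b)
    (hr0 : ∀ e ∈ (c 0).F.support, (c 0).r ≤ e) (hfloor : ∀ k, ordZero (c k).F ≠ p) {k₀ : ℕ} {d : ℕ∞}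
    (hshade : ∀ k, k₀ ≤ k → (c k).shade = d) {e : ℕ}
    (he : ∀ k, k₀ ≤ k → Module.finrank K (resVertex (c k)) = e) {k : ℕ} (hk : k₀ ≤ k) {W : Fin 4}
    (hcone : ∀ v ∈ resVertex (c (k + 1)), v W = 0) : W ≠ j k := by
  rintro rfl
  exact not_coneLetter_newborn p hc hw hr0 hfloor hshade he hk hcone

end

end ResCone

end Summit.ResolutionOfSingularities.ResolutionOfSingularities.Theorems.PIDim4

end
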